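import Literature.MathematicalPhysics.QuantumFieldTheory.Balaban1983to89.B9Thm312WholeStepFrom3131

/-!
# `Balaban1983to89.B9Thm312WholeLeftStepFrom3131` — [B9] Theorem 3.12 (pp. 421–423): THE LEFT SUP ENTRY'S PERTURBATION STEP OF THE
# SECT.-D LEAVES (`B9Thm312WholeLeft.LeftStep.stepD ∕ stepD1`: ∇_UG₀Δ′_π, ∇_UG₀(Δ′_π + Δ⁽²⁾_π) : 𝔠⁽²⁾ → 𝔠_Y⁽¹⁾) PROVED from Theorem 3.3's
# (3.42)₂ for G₀, the mixed entry ∇_UG₀D out of the Hölder class, and the (3.131) ∕ (3.137) letters with the Hölder sizes of their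
# derivative-carrying parts — one composition ([4] (2.54) + (2.61)), no scale transfer

T. Bałaban, *Propagators for lattice gauge theories in a background field*, Commun. Math. Phys. **99** (1985) 389–434
[`Balaban1985BackgroundPropagators`, "B9"]; [4] = T. Bałaban, *Propagators and renormalization transformations for lattice gauge
theories. II*, Commun. Math. Phys. **96** (1984) 223–250 [`Balaban1984PropagatorsII`].

statement-level skeleton of published theorems with citation tags; proofs where landed; nothing here is a claim about the Yang–Mills
mass gap

THE PRINTED LOCUS (verbatim, held text `paper:balaban1985-cmp99-background-propagators`).  p. 421: *"One of the three derivatives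
there has to be applied either to an expression on the right, or on the left, of Δ′_π. For example one of the terms in ⟨A₁, Δ′_πA₂⟩
is … and we apply the derivative D\* to A₁"*; p. 422: *"This inequality [(3.131)] and Theorem 3.3 for G₀ imply a convergence of the
series (3.130), for α₀ sufficiently small, in all norms appearing on the left-hand sides of the inequalities (3.42)–(3.47), except the
inequality involving the Laplace operator in (3.42)"*; p. 398, Theorem 3.1: *"‖ζ∇_UG′(U)λ‖_β, ‖ζG′(U)∇\*_Uλ‖_β ≦ B₀(β)(Lʲη)^{1−β}e^{−δ₀d(y,y′)}
|λ|"* (3.43) and *"|(∇_UG′(U)∇\*_Uλ)(x)| ≦ B′₀(ε)(…)(‖λ‖_ε + |λ|)"* (3.44).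

THE POINT.  After `B9Thm312WholeStepFrom3131` (the sup-class step `Step` of rows 20–21 from Theorem 3.3 for G₀ and the letters
`Letters3131`: Δ′_π = T_a + D·T_b, Δ⁽²⁾_π = T_a₂ + D·T_b₂) the Sect.-D leaves still display the LEFT step `LeftStep.stepD ∕ stepD1`
(n06-d's binder `hleft12`; its Theorem-3.3 member `e1` is rows 18's after `B9Thm312WholeFromThm310.e1_of_conv3107`): the block majorant
θe^{−δ_K d} of ∇_UG₀Δ′_π and ∇_UG₀(Δ′_π + Δ⁽²⁾_π) from 𝔠⁽²⁾ into 𝔠_Y⁽¹⁾.  With the derivative moved to the left the same split gives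
∇_UG₀T = (∇_UG₀)T_a + (∇_UG₀D)T_b: the first product is Theorem 3.3's (3.42)₂ for G₀ (∇_UG₀ : 𝔠⁽⁰⁾ → 𝔠_Y⁽¹⁾) after the derivative-free
letter T_a : 𝔠⁽²⁾ → 𝔠⁽⁰⁾; the second is the MIXED entry ∇_UG₀D — false between pure sup classes ((3.44) needs the Hölder data of its
input; cell GAPS C-pv21g2-1), available OUT OF a Hölder class `bH` of the scalar fields as the letter `B9Thm313WholeLeft.Letters313D.dgDH`
(displayed for row 21) — after the derivative-carrying letter T_b READ INTO `bH`: T_b : 𝔠⁽²⁾ → bH, which print supports by the Hölder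
entries (3.43) of Theorem 3.1 for G′ (the parts under the moved derivative begin with RG′, e.g. RG′ΛDG′RD\* of the third term of
(3.120) and RG′D\*Δ⁽²⁾(I − DG′RD\*) of (3.135)).  THIS FILE types that derivation at the `Ops` level:

* §1 `Letters3131H 𝔬 Tb Tb₂ bH R₀ H₀ hlen t δT U` — THE HÖLDER SIZES OF THE DERIVATIVE-CARRYING LETTERS (printed shape, nothing
  asserted): T_b, T_b₂ : 𝔠⁽²⁾ → bH with t·e^{−δ_T d}.
* §2 `hasMaj_DG0_cNorm` ((3.42)₂ for G₀ as ∇_UG₀ : 𝔠⁽⁰⁾ → 𝔠_Y⁽¹⁾, B₀e^{−δ₀d}), `hasMaj_DG0_comp_split` (ONE composition: ∇_UG₀T =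
  (∇_UG₀)T_a + (∇_UG₀D)T_b : 𝔠⁽²⁾ → 𝔠_Y⁽¹⁾ with (B₀ + κ_H·B₃)·t·c·e^{−ρd}, κ_H = the cutting cost of `bH`).
* §3 ★ `stepD_of_letters3131` (the two `LeftStep` step fields for every θ ≧ 2(B₀ + κ_H B₃)·t·c and 0 ≦ … δ_K ≦ ρ) and ★ `leftStep_of_letters3131`
  (`LeftStep 𝔬 R₀ H₀ hlen B₀ δ₀ θ δK U` from (3.42)₂ for G₀ + the letters — the shape n06-d's `hleft12` consumes).

HONEST SCOPE.  Kernel-checked bookkeeping: the two displayed left-step hypotheses of rows 20–21 become theorems of the displayed letters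
`Letters3131` ∧ `Letters3131H` (HYPOTHESIS SCHEMAS of printed shape — (3.131) ∕ (3.137) and the Hölder sizes are not proved here; located
gap G-B9-16), the displayed mixed letter `dgDH` and Theorem 3.3 for G₀.  The located remark of `B9Thm312WholeStepFrom3131` (raw inputs
versus print's products between propagators in the full state space of (3.42)–(3.46)) applies verbatim.  The Hölder ∕ direction ∕ L² steps
(`StepDir`, `StepH`, `StepL2`), `FormSmall`, `Identities` stay displayed.  COUNT-NEUTRAL; N06 is NOT discharged; one finite lattice at a time;
nothing continuum, nothing about the mass gap.  Cell `pub-ymgap` (HUMAN RULING D-0062), Track A node N06 [B9], N06-ASSIGNMENT v1 rows 20–21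
(bundle F7), seat `pub-ymgap-dag-n06-l` (g11), 2026-08-27.
-/

namespace Literature.MathematicalPhysics.QuantumFieldTheory.Balaban1983to89.B9Thm312WholeLeftStepFrom3131

open Literature.MathematicalPhysics.QuantumFieldTheory.Balaban1983to89
open Finset B6RandomWalk B6RandomWalkHom B9Thm34Ext B11SectG B9SectDSup B9Thm312Whole B9Thm312WholeLeaf B9Thm312WholeLeft
open B9Thm37AllNorms B9Thm312WholeStepFrom3131

noncomputable section

variable {g : B9.Geometry} {B : B9.Backgrounds} {X Y Z W : Type}
variable [Fintype X] [Fintype Y] [Fintype W] [Fintype g.Site]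
variable {R₀ : ℝ} {H₀ : Prop}

/-! ## §1 The Hölder sizes of the derivative-carrying letters (printed shape; nothing asserted) -/

/-- **THE HÖLDER SIZES OF THE DERIVATIVE-CARRYING PARTS OF Δ′_π AND Δ⁽²⁾_π**: with Δ′_π = T_a + D·T_b, Δ⁽²⁾_π = T_a₂ + D·T_b₂ as in
`Letters3131`, the letters T_b, T_b₂ map the state norm 𝔠⁽²⁾ into a block norm `bH` of the scalar site fields (the Hölder class of the
instance, the one through which the mixed entry ∇_UG₀D is read in `Letters313D.dgDH`) with the small local majorant t·e^{−δ_T d(y,y′)} —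
print: the parts under the moved derivative begin with RG′ (third term of (3.120); RG′D\*Δ⁽²⁾(I − DG′RD\*) of (3.135)), whose Hölder sizes
are Theorem 3.1's (3.43) for G′ with (3.49).  A HYPOTHESIS SCHEMA over FREE letters (nothing constructed or asserted).
[cite: Balaban1985BackgroundPropagators, (3.130)–(3.131) pp.421–422 + (3.135)–(3.137) pp.422–423 + (3.43) p.398 + (3.49) p.399] -/
structure Letters3131H (𝔬 : Ops g B X Y Z W) (Tb Tb₂ : B.Cfg → (X → ℝ) →ₗ[ℝ] (W → ℝ)) (R₀ : ℝ) (H₀ : Prop)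
    (hlen : ∀ y : g.Site, 0 ≤ g.len y) (bH : BlockNorm (toB6 g R₀ H₀) (W → ℝ)) (t δT : ℝ) (U : B.Cfg) : Prop where
  tbH : HasMaj (cNorm R₀ H₀ 𝔬.blk hlen 2) bH (Tb U) (fun a b => t * Real.exp (-(δT * g.dist a b)))
  tb₂H : HasMaj (cNorm R₀ H₀ 𝔬.blk hlen 2) bH (Tb₂ U) (fun a b => t * Real.exp (-(δT * g.dist a b)))

/-! ## §2 The entry (3.42)₂ for G₀ in the state classes; one composition -/

omit [Fintype X] [Fintype Y] [Fintype W] [Fintype g.Site] in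
/-- Kernel monotonicity: C·e^{−rd} ≦ θ·e^{−δ_K d} for 0 ≦ C ≦ θ, δ_K ≦ r, d ≧ 0. [folklore] -/
private theorem kernel_le' {C θ r δK d : ℝ} (hC : 0 ≤ C) (hCθ : C ≤ θ) (hδK : δK ≤ r) (hd : 0 ≤ d) :
    C * Real.exp (-(r * d)) ≤ θ * Real.exp (-(δK * d)) :=
  calc C * Real.exp (-(r * d)) ≤ C * Real.exp (-(δK * d)) :=
      mul_le_mul_of_nonneg_left (Real.exp_le_exp.mpr (neg_le_neg (mul_le_mul_of_nonneg_right hδK hd))) hC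
    _ ≤ θ * Real.exp (-(δK * d)) := mul_le_mul_of_nonneg_right hCθ (Real.exp_nonneg _)

omit [Fintype W] in
/-- **THEOREM 3.3 (3.42)₂ FOR G₀ AS A MAP OF STATE CLASSES**: the [4]-(2.51) majorant |(∇_UG₀λ)(x)| ≦ B₀Lʲη·e^{−δ₀d(y,y′)}|λ| (x ∈ Δ(y),
supp λ ⊂ Δ(y′)) is the majorant B₀e^{−δ₀d} of ∇_UG₀ from 𝔠⁽⁰⁾ into 𝔠_Y⁽¹⁾ (the power Lʲη taken inside the target size).
[cite: Balaban1985BackgroundPropagators, Thm 3.3 p.399 + (3.42) p.397; Balaban1984PropagatorsII, (2.51) p.232] -/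
theorem hasMaj_DG0_cNorm (hG : GeoOK g) {blk : X → g.Site} {blkY : Y → g.Site} {G0 : Module.End ℝ (X → ℝ)}
    {Dop : (X → ℝ) →ₗ[ℝ] (Y → ℝ)} {B₀ δ₀ : ℝ} (hB₀ : 0 ≤ B₀)
    (he1 : HasMajorantHom (g := toB6 g R₀ H₀) blk blkY (Dop ∘ₗ G0)
      (fun (a b : g.Site) => B₀ * g.len a * Real.exp (-(δ₀ * g.dist a b)))) :
    HasMaj (cNorm R₀ H₀ blk hG.lenle 0) (cNorm R₀ H₀ blkY hG.lenle 1) (Dop ∘ₗ G0)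
      (fun a b => B₀ * Real.exp (-(δ₀ * g.dist a b))) := by
  have h10 : HasMaj (BlockNorm.ofBlocks (toB6 g R₀ H₀) blk) (BlockNorm.ofBlocks (toB6 g R₀ H₀) blkY) (Dop ∘ₗ G0)
      (fun a b => B₀ * g.len a * Real.exp (-(δ₀ * g.dist a b))) :=
    hasMaj_of_hasMajorantHom (G := toB6 g R₀ H₀) blk blkY
      (fun a b => mul_nonneg (mul_nonneg hB₀ (hG.lenle a)) (Real.exp_nonneg _)) he1
  refine (hasMaj_cNorm_of_hasMaj hG 1 0 h10).mono fun y y' => le_of_eq ?_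
  have hy : g.len y ≠ 0 := (hG.lenpos y).ne'
  simp only [wt, pow_zero, pow_one, mul_one]
  rw [mul_assoc B₀, mul_comm (g.len y), ← mul_assoc B₀, mul_assoc, mul_inv_cancel₀ hy, mul_one]

omit [Fintype W] in
/-- **ONE COMPOSITION — THE LEFT PRODUCT ∇_UG₀T FOR A SPLIT PERTURBATION T = T_a + D·T_b**: with ∇_UG₀ : 𝔠⁽⁰⁾ → 𝔠_Y⁽¹⁾ (B₀e^{−δ₀d}),
the mixed entry ∇_UG₀D : bH → 𝔠_Y⁽¹⁾ (B₃e^{−δ₃d}) out of a block norm `bH` of cutting cost κ_H, and the letters T_a : 𝔠⁽²⁾ → 𝔠⁽⁰⁾,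
T_b : 𝔠⁽²⁾ → bH (t·e^{−δ_T d}), the product ∇_UG₀T = (∇_UG₀)T_a + (∇_UG₀D)T_b maps 𝔠⁽²⁾ into 𝔠_Y⁽¹⁾ with the majorant
(B₀ + κ_H·B₃)·t·c·e^{−ρd} for every ρ ≧ 0 with ρ ≦ δ_T, ρ + σ ≦ δ₀, ρ + σ ≦ δ₃ — [4] (2.54) and Lemma 2.1 (2.61) at the margin σ.
[cite: Balaban1985BackgroundPropagators, (3.130)–(3.131) pp.421–422 + (3.42)–(3.44) pp.397–398; Balaban1984PropagatorsII, (2.52)–(2.56) pp.232–233 + Lemma 2.1 (2.61) p.234] -/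
theorem hasMaj_DG0_comp_split (hG : GeoOK g) {blk : X → g.Site} {blkY : Y → g.Site} {bH : BlockNorm (toB6 g R₀ H₀) (W → ℝ)}
    {G0 T Ta : Module.End ℝ (X → ℝ)} {Dop : (X → ℝ) →ₗ[ℝ] (Y → ℝ)} {Dv : (W → ℝ) →ₗ[ℝ] (X → ℝ)}
    {Tb : (X → ℝ) →ₗ[ℝ] (W → ℝ)} {B₀ B₃ t δ₀ δ₃ δT ρ σ c : ℝ} (hrow : RowSum (toB6 g R₀ H₀) σ c)
    (hB₀ : 0 ≤ B₀) (hB₃ : 0 ≤ B₃) (ht : 0 ≤ t) (hρ : 0 ≤ ρ) (hρT : ρ ≤ δT) (hρ₀ : ρ + σ ≤ δ₀) (hρ₃ : ρ + σ ≤ δ₃)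
    (hsplit : T = Ta + Dv ∘ₗ Tb)
    (hDG0 : HasMaj (cNorm R₀ H₀ blk hG.lenle 0) (cNorm R₀ H₀ blkY hG.lenle 1) (Dop ∘ₗ G0)
      (fun a b => B₀ * Real.exp (-(δ₀ * g.dist a b))))
    (hDGD : HasMaj bH (cNorm R₀ H₀ blkY hG.lenle 1) (Dop ∘ₗ G0 ∘ₗ Dv)
      (fun a b => B₃ * Real.exp (-(δ₃ * g.dist a b))))
    (hta : HasMaj (cNorm R₀ H₀ blk hG.lenle 2) (cNorm R₀ H₀ blk hG.lenle 0) Ta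
      (fun a b => t * Real.exp (-(δT * g.dist a b))))
    (htbH : HasMaj (cNorm R₀ H₀ blk hG.lenle 2) bH Tb (fun a b => t * Real.exp (-(δT * g.dist a b)))) :
    HasMaj (cNorm R₀ H₀ blk hG.lenle 2) (cNorm R₀ H₀ blkY hG.lenle 1) (Dop ∘ₗ G0 ∘ₗ T)
      (fun a b => (B₀ + bH.κ * B₃) * t * c * Real.exp (-(ρ * g.dist a b))) := by
  have htri : Triangle254 (toB6 g R₀ H₀) := fun a b c => hG.tri a b c
  have h1 := hasMaj_comp_exp htri hG.dnn hrow hB₀ ht hρ hρT hρ₀ hDG0 hta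
  have h2 := hasMaj_comp_exp htri hG.dnn hrow hB₃ ht hρ hρT hρ₃ hDGD htbH
  refine ((h1.add h2).congr fun μ => ?_).mono fun a b => le_of_eq ?_
  · rw [hsplit]
    simp only [LinearMap.add_apply, LinearMap.comp_apply, map_add]
  · simp only [cNorm_κ, toB6_dist]
    ring

/-! ## §3 The left step of rows 20–21 from (3.42)₂ for G₀, the mixed letter and the (3.131) ∕ (3.137) letters -/

/-- **THE TWO LEFT-STEP FIELDS OF `LeftStep`** — ∇_UG₀Δ′_π and ∇_UG₀(Δ′_π + Δ⁽²⁾_π) have the block majorant θe^{−δ_K d} from 𝔠⁽²⁾ into 𝔠_Y⁽¹⁾ —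
from Theorem 3.3's (3.42)₂ for G₀ (`he1`, the shape of `LeftStep.e1`; rows 18's after `B9Thm312WholeFromThm310.e1_of_conv3107`), the mixed
letter ∇_UG₀D out of `bH` (`hdgDH`, the shape of `Letters313D.dgDH`), the letters `Letters3131` (their derivative-free parts) and
`Letters3131H` (the Hölder sizes of their derivative-carrying parts) and the row sum (2.61) at rate σ, for EVERY θ ≧ 2(B₀ + κ_H·B₃)·t·c and
δ_K ≦ ρ (0 ≦ ρ ≦ δ_T, ρ + σ ≦ min(δ₀, δ₃)).  These are the hypotheses `hsd`, `hsd1` of `B9Thm312WholeFromThm310.leftStep_of_conv3107`.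
[cite: Balaban1985BackgroundPropagators, Thm 3.12 p.423 + (3.130)–(3.131) pp.421–422 + (3.137)–(3.138) p.423 + (3.42)–(3.44) pp.397–398; Balaban1984PropagatorsII, (2.54) p.233 + Lemma 2.1 (2.61) p.234] -/
theorem stepD_of_letters3131 (hG : GeoOK g) {𝔬 : Ops g B X Y Z W} {Ta Ta₂ : B.Cfg → Module.End ℝ (X → ℝ)}
    {Tb Tb₂ : B.Cfg → (X → ℝ) →ₗ[ℝ] (W → ℝ)} {bH : BlockNorm (toB6 g R₀ H₀) (W → ℝ)} {U : B.Cfg}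
    {B₀ B₃ t δ₀ δ₃ δT ρ σ c θ δK : ℝ}
    (hrow : RowSum (toB6 g R₀ H₀) σ c) (hc : 0 ≤ c) (hB₀ : 0 ≤ B₀) (hB₃ : 0 ≤ B₃) (ht : 0 ≤ t) (hρ : 0 ≤ ρ) (hρT : ρ ≤ δT)
    (hρ₀ : ρ + σ ≤ δ₀) (hρ₃ : ρ + σ ≤ δ₃) (hθ : 2 * ((B₀ + bH.κ * B₃) * t * c) ≤ θ) (hδK : δK ≤ ρ)
    (he1 : HasMajorantHom (g := toB6 g R₀ H₀) 𝔬.blk 𝔬.blkY (𝔬.D U ∘ₗ 𝔬.G0 U)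
      (fun (a b : g.Site) => B₀ * g.len a * Real.exp (-(δ₀ * g.dist a b))))
    (hdgDH : HasMaj bH (cNorm R₀ H₀ 𝔬.blkY hG.lenle 1) (𝔬.D U ∘ₗ 𝔬.G0 U ∘ₗ 𝔬.Dv U)
      (fun a b => B₃ * Real.exp (-(δ₃ * g.dist a b))))
    (hL : Letters3131 𝔬 Ta Ta₂ Tb Tb₂ R₀ H₀ hG.lenle t δT U) (hLH : Letters3131H 𝔬 Tb Tb₂ R₀ H₀ hG.lenle bH t δT U) :
    HasMaj (cNorm R₀ H₀ 𝔬.blk hG.lenle 2) (cNorm R₀ H₀ 𝔬.blkY hG.lenle 1) (𝔬.D U ∘ₗ 𝔬.G0 U ∘ₗ 𝔬.Tpi U)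
        (fun a b => θ * Real.exp (-(δK * (toB6 g R₀ H₀).dist a b))) ∧
      HasMaj (cNorm R₀ H₀ 𝔬.blk hG.lenle 2) (cNorm R₀ H₀ 𝔬.blkY hG.lenle 1) (𝔬.D U ∘ₗ 𝔬.G0 U ∘ₗ (𝔬.Tpi U + 𝔬.T2 U))
        (fun a b => θ * Real.exp (-(δK * (toB6 g R₀ H₀).dist a b))) := by
  have hD0 := hasMaj_DG0_cNorm (R₀ := R₀) (H₀ := H₀) hG hB₀ he1
  have hA := hasMaj_DG0_comp_split hG hrow hB₀ hB₃ ht hρ hρT hρ₀ hρ₃ hL.split hD0 hdgDH hL.ta hLH.tbH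
  have hB := hasMaj_DG0_comp_split hG hrow hB₀ hB₃ ht hρ hρT hρ₀ hρ₃ hL.split₂ hD0 hdgDH hL.ta₂ hLH.tb₂H
  have hK : 0 ≤ (B₀ + bH.κ * B₃) * t * c :=
    mul_nonneg (mul_nonneg (add_nonneg hB₀ (mul_nonneg bH.κ_nonneg hB₃)) ht) hc
  have hc1 : (B₀ + bH.κ * B₃) * t * c ≤ θ := by linarith
  refine ⟨hA.mono fun a b => ?_, ((hA.add hB).congr fun μ => ?_).mono fun a b => ?_⟩
  · simp only [toB6_dist]
    exact kernel_le' hK hc1 hδK (hG.dnn a b)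
  · simp only [LinearMap.add_apply, LinearMap.comp_apply, map_add]
  · simp only [toB6_dist]
    calc (B₀ + bH.κ * B₃) * t * c * Real.exp (-(ρ * g.dist a b)) + (B₀ + bH.κ * B₃) * t * c * Real.exp (-(ρ * g.dist a b))
        = 2 * ((B₀ + bH.κ * B₃) * t * c) * Real.exp (-(ρ * g.dist a b)) := by ring
      _ ≤ θ * Real.exp (-(δK * g.dist a b)) := kernel_le' (mul_nonneg (by norm_num) hK) hθ hδK (hG.dnn a b)

/-- ★ **THE SCHEMA `LeftStep` OF ROWS 20–21 FROM (3.42)₂ FOR G₀ AND THE LETTERS** — the shape n06-d's binder `hleft12` consumes: its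
Theorem-3.3 member `e1` is the hypothesis `he1` (rows 18's after `e1_of_conv3107`), its two Sect.-D step members are `stepD_of_letters3131`.
[cite: Balaban1985BackgroundPropagators, Thm 3.12 p.423 + (3.42) p.397 + (3.130)–(3.131) pp.421–422 + (3.137)–(3.138) p.423] -/
theorem leftStep_of_letters3131 (hG : GeoOK g) {𝔬 : Ops g B X Y Z W} {Ta Ta₂ : B.Cfg → Module.End ℝ (X → ℝ)}
    {Tb Tb₂ : B.Cfg → (X → ℝ) →ₗ[ℝ] (W → ℝ)} {bH : BlockNorm (toB6 g R₀ H₀) (W → ℝ)} {U : B.Cfg}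
    {B₀ B₃ t δ₀ δ₃ δT ρ σ c θ δK : ℝ}
    (hrow : RowSum (toB6 g R₀ H₀) σ c) (hc : 0 ≤ c) (hB₀ : 0 ≤ B₀) (hB₃ : 0 ≤ B₃) (ht : 0 ≤ t) (hρ : 0 ≤ ρ) (hρT : ρ ≤ δT)
    (hρ₀ : ρ + σ ≤ δ₀) (hρ₃ : ρ + σ ≤ δ₃) (hθ : 2 * ((B₀ + bH.κ * B₃) * t * c) ≤ θ) (hδK : δK ≤ ρ)
    (he1 : HasMajorantHom (g := toB6 g R₀ H₀) 𝔬.blk 𝔬.blkY (𝔬.D U ∘ₗ 𝔬.G0 U)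
      (fun (a b : g.Site) => B₀ * g.len a * Real.exp (-(δ₀ * g.dist a b))))
    (hdgDH : HasMaj bH (cNorm R₀ H₀ 𝔬.blkY hG.lenle 1) (𝔬.D U ∘ₗ 𝔬.G0 U ∘ₗ 𝔬.Dv U)
      (fun a b => B₃ * Real.exp (-(δ₃ * g.dist a b))))
    (hL : Letters3131 𝔬 Ta Ta₂ Tb Tb₂ R₀ H₀ hG.lenle t δT U) (hLH : Letters3131H 𝔬 Tb Tb₂ R₀ H₀ hG.lenle bH t δT U) :
    LeftStep 𝔬 R₀ H₀ hG.lenle B₀ δ₀ θ δK U := by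
  obtain ⟨hsd, hsd1⟩ := stepD_of_letters3131 hG hrow hc hB₀ hB₃ ht hρ hρT hρ₀ hρ₃ hθ hδK he1 hdgDH hL hLH
  exact ⟨he1, hsd, hsd1⟩

end

end Literature.MathematicalPhysics.QuantumFieldTheory.Balaban1983to89.B9Thm312WholeLeftStepFrom3131
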